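import Summits.QuantumFields.YangMills.Theorems.UnitScaleTiltProp7TransportedBumpFlatRow
import Summits.QuantumFields.YangMills.Theorems.UnitScaleTiltProp7LaplaceAFlatLetters
import Summits.QuantumFields.YangMills.Theorems.UnitScaleTiltProp7QTwSLocalGaugeComparisonAllFields
import Summits.QuantumFields.YangMills.Theorems.UnitScaleTiltProp7LineAvgTridiagonal
import HarnessLib

/-!
# Route `UnitScaleTilt`, crux K1 «MinimiserStabilityRegPr» (stmt-QuantumFields-19200), EX face — K-storey (px12 g16 LOCATE-K137), pen (K1b-a) (px13 g15; LOCATE #43 §6 (F2c, part 1)) —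
# **HILBERT–SCHMIDT BOOKKEEPING OF THE TRANSPORTED BUMPS**: the norm of the interpolant field EXACTLY, the spill-shift isometry, the bounded-overlap Cauchy–Schwarz, the bump decomposition

Cell `ym3-torus` (HUMAN RULING D-0037; rung R3 = SU(2) YM₃ on T³ — NOT d = 4, NOT infinite volume, NOT a mass gap, NOT Clay).  Width seat `ym3-torus-px13` (gen 15).  THEOREMS ONLY
(0 `def`, 0 `sorry`); `--supports stmt-QuantumFields-19200 --as helper`; count-neutral; nothing of Bałaban's asserted.

THE INTERPOLANT FIELD (LOCATE #43 §3, all inline; `k = K − n`, `ℓ = L^k`, `ŷ_b := ⟨B^k b₋, b.dir⟩`, `e := bondShift (sites_eq F n K h)`): for a coarse datum `C : PBond (F.P n) 0 → M₂(ℂ)` and an amplitude `m`,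
`A_C(b) := ψ(b) • Ad_{(σ_{ŷ_b}(b₋)♭)⁻¹}(m • Ad_{Φ(B^k b₋)} C(e⁻¹ ŷ_b))`, `σ_ŷ := axialT W c(ŷ.src)`, `Φ(z) := axialT (unitsField (toUField W)) c(z) (embIter k z)`, `ψ` the separable block profile of
✓`Prop7TransportedBumpFlatRow`; it is the sum over `ŷ` of that file's bumps `A_ŷ` with values `V_ŷ := m • Ad_{Φ(ŷ.src)} C(e⁻¹ŷ)`.

WHAT IS PROVED (ns `…Theorems.Prop7TransportedBumpNorms`).
* §1 (generic) `sum_normSq_smul_real` (`Σ|(r•X)_{ij}|² = r²Σ|X_{ij}|²`); ★ `sum_normSq_sum_le_of_support` (entries `e_i(c)` vanishing for `i ∉ S(c)`, `|S(c)| ≤ N` ⟹ `Σ_c‖Σ_i e_i(c)‖²_HS ≤ N·Σ_iΣ_c‖e_i(c)‖²_HS`);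
  `card_filter_src_eq` (`d` bonds start at a site), `card_filter_src_or_le` (`≤ 2d` bonds start at one of two sites).
* §2 (generic `P`, level `k`) ★ `sum_pbond_profileSq_mul` — THE PROFILE MASS REGROUPING `Σ_b ψ(b)²·g(ŷ_b) = Ψ₂·Σ_ŷ g(ŷ)`, `Ψ₂ := (Σ_{a<ℓ}p(a)²)·(Σ_{a<ℓ}τ(a)²)^{d−1}` (✓`sum_pbond`, blocks as fibres,
  ✓`sum_iterBlock_eq`, ✓`offset_fibreSite`, ✓`sum_pi_mul_prod_erase`).
* §3 (member) `axialFrame_mem_U1` (`Φ(z) ∈ U1`); ★★ `normSq_toL2_interpolant` — `‖toL2 A_C‖² = c₀·m²·Ψ₂·cB⁻¹·‖toL2B C‖²` EXACTLY (Hilbert–Schmidt sums are `Ad_{U1}`-invariant ✓`sum_normSq_conjR_eq`, §2);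
  ★ `normSq_toL2B_spillShift` — `‖toL2B(c′ ↦ r • Ad_{u(c′)} C(e⁻¹⟨ĉ′.tgt, ĉ′.dir⟩))‖² = r²·‖toL2B C‖²` for `U1`-valued `u` (the forward bond shift is a bijection ✓`sum_pbond_runSite_one`).
* §4 (member) `bump_sum_apply` (`Σ_ŷ A_ŷ(b) = A_C(b)`: one bump per fine bond), ★ `sum_normSq_toL2_bump` (`Σ_ŷ ‖toL2 A_ŷ‖² = ‖toL2 A_C‖²`: disjoint supports).
HONEST SCOPE.  Bookkeeping; row (a), (s1) as displayed rows, (s2), (K1b), K137, EX and the crux are NOT proved here (part 2 ∕ F3).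

References: T. Bałaban, CMP **98** (1985) 17–51 [Balaban1985Averaging] ((2) p.17, (5) p.18, (18)–(20) p.21); CMP **99** (1985) 389–434 [Balaban1985BackgroundPropagators] ((3.11)–(3.16) pp.392–393).
-/

set_option autoImplicit false

noncomputable section

open scoped BigOperators Matrix.Norms.L2Operator Matrix

namespace Summit.QuantumFields.YangMills.Theorems.Prop7TransportedBumpNorms

open Literature.MathematicalPhysics.QuantumFieldTheory.Balaban1983to89
open Literature.MathematicalPhysics.QuantumFieldTheory.Balaban1983to89.T3ContinuumYM3Torus
open Finset T4Continuum BlockAveraging LatticeFieldCalculus B1RG242Torus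
open B5Eq118OneStroke (iterBlockOf iterBlock mem_iterBlock)
open B5Eq117TorusCarriers (sum_iterBlock_eq)
open B7Prop1Explicit (U1)
open B7Eq78Linearization (conjR conjR_apply conjR_add conjR_smul conjR_smul_real)
open B8Ineq132 (conjR_conjR one_conjR)
open B10Eq27TorusAxialLog (axialT axialT_self unitsField toUField suIncl)
open B10StarCount (sum_pbond)
open B11Eq103H1Complex (BondL2K)
open B15DeterminingSets (embIter)
open T3LevelShift (bondShift)
open T3PrintedRegularOrbits (sites_eq)
open T3SectALandauChart (eta eta_pos)
open Summit.QuantumFields.YangMills.Theorems.Prop7SectET3HilbertLetters (toL2 toL2B)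
open Summit.QuantumFields.YangMills.Theorems.Prop7SymAvgTwSym (holT_mem_U1 unitsField_toUField_mem_U1')
open Summit.QuantumFields.YangMills.Theorems.Prop7CombGauge (iterBlockOf_fibreSite)
open Summit.QuantumFields.YangMills.Theorems.Prop7FlatHolonomy (sitesPerDir_zero_eq_mul_pow)
open Summit.QuantumFields.YangMills.Theorems.Prop7QTwSLocalGaugeComparisonAllFields (sum_normSq_conjR_eq toUnits_suIncl_mem_U1)
open Summit.QuantumFields.YangMills.Theorems.Prop7LaplaceAFlatLetters (norm_sq_toL2 norm_sq_toL2B)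
open Summit.QuantumFields.YangMills.Theorems.Prop7LineAvgRightInverse (sum_pbond_runSite_one runSite_one)
open Summit.QuantumFields.YangMills.Theorems.Prop7BlockProfileTubeSums (offset_fibreSite sum_pi_mul_prod_erase)
open Summit.QuantumFields.YangMills.Theorems.Prop7TransportedBumpFlatRow (pbond_eq_iff)

/-! ## §1 Generic Hilbert–Schmidt bookkeeping -/

section Generic

/-- `Σ_{ij}|(r•X)_{ij}|² = r²·Σ_{ij}|X_{ij}|²` for a real scalar. [folklore] -/
theorem sum_normSq_smul_real (r : ℝ) (X : Matrix (Fin 2) (Fin 2) ℂ) :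
    ∑ i, ∑ j, ‖(r • X) i j‖ ^ 2 = r ^ 2 * ∑ i, ∑ j, ‖X i j‖ ^ 2 := by
  simp only [Matrix.smul_apply, norm_smul, Real.norm_eq_abs, mul_pow, sq_abs, Finset.mul_sum]

/-- ★ **BOUNDED-OVERLAP CAUCHY–SCHWARZ**: if the entry `e_i(c)` vanishes unless `i ∈ S(c)` and `|S(c)| ≤ N` for every `c`, then `Σ_c ‖Σ_i e_i(c)‖²_HS ≤ N·Σ_i Σ_c ‖e_i(c)‖²_HS`. [folklore] -/
theorem sum_normSq_sum_le_of_support {ι κ : Type*} [Fintype ι] [Fintype κ] (e : ι → κ → Matrix (Fin 2) (Fin 2) ℂ) (S : κ → Finset ι) (N : ℕ)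
    (hS : ∀ c i, i ∉ S c → e i c = 0) (hN : ∀ c, (S c).card ≤ N) :
    ∑ c, ∑ j, ∑ k, ‖(∑ i, e i c) j k‖ ^ 2 ≤ (N : ℝ) * ∑ i, ∑ c, ∑ j, ∑ k, ‖e i c j k‖ ^ 2 := by
  classical
  have hper : ∀ c j k, ‖(∑ i, e i c) j k‖ ^ 2 ≤ (N : ℝ) * ∑ i, ‖e i c j k‖ ^ 2 := by
    intro c j k
    have hsum : (∑ i, e i c) j k = ∑ i ∈ S c, e i c j k := by
      rw [Matrix.sum_apply]
      exact (Finset.sum_subset (Finset.subset_univ _) fun i _ hi => by rw [hS c i hi]; rfl).symm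
    rw [hsum]
    calc ‖∑ i ∈ S c, e i c j k‖ ^ 2 ≤ (∑ i ∈ S c, ‖e i c j k‖) ^ 2 := pow_le_pow_left₀ (norm_nonneg _) (norm_sum_le _ _) 2
      _ ≤ ((S c).card : ℝ) * ∑ i ∈ S c, ‖e i c j k‖ ^ 2 := sq_sum_le_card_mul_sum_sq
      _ ≤ (N : ℝ) * ∑ i, ‖e i c j k‖ ^ 2 :=
          mul_le_mul (by exact_mod_cast hN c) (Finset.sum_le_univ_sum_of_nonneg fun i => sq_nonneg _) (Finset.sum_nonneg fun _ _ => sq_nonneg _) (Nat.cast_nonneg _)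
  calc ∑ c, ∑ j, ∑ k, ‖(∑ i, e i c) j k‖ ^ 2 ≤ ∑ c, ∑ j, ∑ k, ((N : ℝ) * ∑ i, ‖e i c j k‖ ^ 2) :=
        Finset.sum_le_sum fun c _ => Finset.sum_le_sum fun j _ => Finset.sum_le_sum fun k _ => hper c j k
    _ = (N : ℝ) * ∑ c, ∑ j, ∑ k, ∑ i, ‖e i c j k‖ ^ 2 := by simp only [Finset.mul_sum]
    _ = (N : ℝ) * ∑ i, ∑ c, ∑ j, ∑ k, ‖e i c j k‖ ^ 2 := by
        congr 1
        calc ∑ c, ∑ j, ∑ k, ∑ i, ‖e i c j k‖ ^ 2 = ∑ c, ∑ j, ∑ i, ∑ k, ‖e i c j k‖ ^ 2 :=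
              Finset.sum_congr rfl fun c _ => Finset.sum_congr rfl fun j _ => Finset.sum_comm
          _ = ∑ c, ∑ i, ∑ j, ∑ k, ‖e i c j k‖ ^ 2 := Finset.sum_congr rfl fun c _ => Finset.sum_comm
          _ = ∑ i, ∑ c, ∑ j, ∑ k, ‖e i c j k‖ ^ 2 := Finset.sum_comm

/-- Exactly `d` positively oriented bonds start at a given site. [cite: Balaban1985Averaging, (5) p.18] -/
theorem card_filter_src_eq {P : Params} {j : ℕ} (a : Site P j) : (univ.filter fun y : PBond P j => y.src = a).card = P.d := by
  classical
  have hset : (univ.filter fun y : PBond P j => y.src = a) = (univ : Finset (Fin P.d)).map ⟨fun μ => (⟨a, μ⟩ : PBond P j), fun μ ν hμν => by simpa using congrArg PBond.dir hμν⟩ := by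
    ext y
    simp only [Finset.mem_filter, Finset.mem_univ, true_and, Finset.mem_map, Function.Embedding.coeFn_mk]
    constructor
    · intro hy
      exact ⟨y.dir, (pbond_eq_iff _ _).mpr ⟨hy.symm, rfl⟩⟩
    · rintro ⟨μ, rfl⟩
      rfl
  rw [hset, Finset.card_map, Finset.card_univ, Fintype.card_fin]

/-- At most `2d` positively oriented bonds start at one of two given sites. [cite: Balaban1985Averaging, (5) p.18] -/
theorem card_filter_src_or_le {P : Params} {j : ℕ} (a a' : Site P j) : (univ.filter fun y : PBond P j => y.src = a ∨ y.src = a').card ≤ 2 * P.d := by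
  classical
  calc (univ.filter fun y : PBond P j => y.src = a ∨ y.src = a').card
        ≤ (univ.filter fun y : PBond P j => y.src = a).card + (univ.filter fun y : PBond P j => y.src = a').card := by
          rw [Finset.filter_or]; exact Finset.card_union_le _ _
    _ = 2 * P.d := by rw [card_filter_src_eq, card_filter_src_eq]; ring

end Generic

/-! ## §2 The profile mass regrouping (generic `P`, level `k`) -/

section Profile

variable {P : Params} {k : ℕ}

/-- ★ **THE PROFILE MASS REGROUPING**: `Σ_b ψ(b)²·g(ŷ_b) = Ψ₂·Σ_ŷ g(ŷ)` with `ψ(b) = p(off_{b.dir}b₋)·Π_{ν≠b.dir}τ(off_ν b₋)`, `ŷ_b = ⟨B^k b₋, b.dir⟩`, `Ψ₂ = (Σ_a p(a)²)(Σ_a τ(a)²)^{d−1}`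
(standing range): every coarse bond carries one block of fine bonds whose profile squares factorise. [cite: Balaban1985Averaging, (2) p.17, (5) p.18] -/
theorem sum_pbond_profileSq_mul (hk : k ≤ P.m + P.K) (p τ : ℕ → ℝ) (g : PBond P k → ℝ) :
    ∑ b : PBond P 0, (p ((b.src b.dir).val % P.L ^ k) * ∏ ν ∈ univ.erase b.dir, τ ((b.src ν).val % P.L ^ k)) ^ 2 * g ⟨iterBlockOf k b.src, b.dir⟩
      = ((∑ a : Fin (P.L ^ k), p a ^ 2) * (∑ a : Fin (P.L ^ k), τ a ^ 2) ^ (P.d - 1)) * ∑ y : PBond P k, g y := by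
  classical
  -- blocks as fibres of the site sum
  have hfib : ∀ G : Site P 0 → ℝ, ∑ x, G x = ∑ z : Site P k, ∑ x ∈ iterBlock k z, G x := fun G => by
    rw [← Finset.sum_fiberwise_of_maps_to (s := univ) (t := univ) (g := fun x : Site P 0 => iterBlockOf k x) (fun _ _ => mem_univ _)]
    refine Finset.sum_congr rfl fun z _ => Finset.sum_congr ?_ fun _ _ => rfl
    ext x
    simp only [Finset.mem_filter, Finset.mem_univ, true_and, mem_iterBlock]
  -- the block sum of the squared profile: `Σ_r p(r μ)²·Π τ(r ν)² = Ψ₂`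
  have hblock : ∀ (z : Site P k) (μ : Fin P.d),
      ∑ x ∈ iterBlock k z, (p ((x μ).val % P.L ^ k) * ∏ ν ∈ univ.erase μ, τ ((x ν).val % P.L ^ k)) ^ 2 * g ⟨iterBlockOf k x, μ⟩
        = ((∑ a : Fin (P.L ^ k), p a ^ 2) * (∑ a : Fin (P.L ^ k), τ a ^ 2) ^ (P.d - 1)) * g ⟨z, μ⟩ := by
    intro z μ
    have hP : P.sitesPerDir 0 = P.L ^ k * P.sitesPerDir k := by rw [sitesPerDir_zero_eq_mul_pow hk, mul_comm]
    have h1 : ∑ x ∈ iterBlock k z, (p ((x μ).val % P.L ^ k) * ∏ ν ∈ univ.erase μ, τ ((x ν).val % P.L ^ k)) ^ 2 * g ⟨iterBlockOf k x, μ⟩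
        = ∑ r : Fin P.d → Fin (P.L ^ k), (p (r μ) * ∏ ν ∈ univ.erase μ, τ (r ν)) ^ 2 * g ⟨z, μ⟩ := by
      rw [sum_iterBlock_eq hk z]
      refine Finset.sum_congr rfl fun r _ => ?_
      show (p (((Site.fibreSite 0 k z r) μ).val % P.L ^ k) * ∏ ν ∈ univ.erase μ, τ (((Site.fibreSite 0 k z r) ν).val % P.L ^ k)) ^ 2 * g ⟨iterBlockOf k (Site.fibreSite 0 k z r), μ⟩ = _
      simp only [offset_fibreSite hk, iterBlockOf_fibreSite hk hP]
    rw [h1, ← Finset.sum_mul]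
    congr 1
    have h2 : ∀ r : Fin P.d → Fin (P.L ^ k), (p (r μ) * ∏ ν ∈ univ.erase μ, τ (r ν)) ^ 2 = p (r μ) ^ 2 * ∏ ν ∈ univ.erase μ, τ (r ν) ^ 2 := fun r => by
      rw [mul_pow, Finset.prod_pow]
    simp only [h2]
    exact sum_pi_mul_prod_erase μ (fun a => p a ^ 2) (fun a => τ a ^ 2)
  rw [sum_pbond, hfib, sum_pbond (fun y : PBond P k => g y), Finset.mul_sum]
  refine Finset.sum_congr rfl fun z _ => ?_
  rw [Finset.sum_comm, Finset.mul_sum]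
  exact Finset.sum_congr rfl fun μ _ => hblock z μ

end Profile

/-! ## §3 The member: the interpolant field's norm exactly and the spill-shift isometry -/

section Member

variable (F : T3Family) (n K : ℕ) (h : n ≤ K) (c₀ cB : ℝ) [Fact (0 < c₀)] [Fact (0 < cB)]

/-- The (iv) frame `Φ(z) = axialT (unitsField (toUField W)) c(z) (embIter k z)` is `U1`-valued (a product of unitaries). [cite: Balaban1985Averaging, (19) p.21] -/
theorem axialFrame_mem_U1 (W : GaugeField (F.P K) 0 (Matrix.specialUnitaryGroup (Fin 2) ℂ)) (c x : Site (F.P K) 0) :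
    axialT (unitsField (toUField W)) c x ∈ U1 (Matrix (Fin 2) (Fin 2) ℂ) := by
  unfold axialT
  exact holT_mem_U1 (fun b => unitsField_toUField_mem_U1' W b) _ _

/-- ★★ **THE NORM OF THE INTERPOLANT FIELD, EXACTLY**: `‖toL2 A_C‖² = c₀·(m²Ψ₂)·(cB⁻¹‖toL2B C‖²)` — per fine bond `‖A_C(b)‖²_HS = ψ(b)²m²‖C(e⁻¹ŷ_b)‖²_HS` (`Ad_{U1}`-invariance
✓`sum_normSq_conjR_eq`), then §2 and `e` a bijection. [cite: Balaban1985BackgroundPropagators, (3.11) p.392; Balaban1985Averaging, (18)–(20) p.21] -/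
theorem normSq_toL2_interpolant (W : GaugeField (F.P K) 0 (Matrix.specialUnitaryGroup (Fin 2) ℂ)) (p τ : ℕ → ℝ) (m : ℝ) (C : PBond (F.P n) 0 → Matrix (Fin 2) (Fin 2) ℂ) :
    ‖toL2 F K c₀ (fun b : PBond (F.P K) 0 =>
        (p ((b.src b.dir).val % (F.P K).L ^ (K - n)) * ∏ ν ∈ univ.erase b.dir, τ ((b.src ν).val % (F.P K).L ^ (K - n)))
          • conjR (Unitary.toUnits (suIncl ((axialT W (Site.fibreSite 0 (K - n) (iterBlockOf (K - n) b.src) fun _ => (⟨0, pow_pos (F.P K).L_pos (K - n)⟩ : Fin ((F.P K).L ^ (K - n))))) b.src)))⁻¹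
              (m • conjR (axialT (unitsField (toUField W)) (Site.fibreSite 0 (K - n) (iterBlockOf (K - n) b.src) fun _ => (⟨0, pow_pos (F.P K).L_pos (K - n)⟩ : Fin ((F.P K).L ^ (K - n)))) (embIter (K - n) (iterBlockOf (K - n) b.src)))
                (C ((bondShift (sites_eq F n K h)).symm ⟨iterBlockOf (K - n) b.src, b.dir⟩))))‖ ^ 2
      = c₀ * (m ^ 2 * ((∑ a : Fin ((F.P K).L ^ (K - n)), p a ^ 2) * (∑ a : Fin ((F.P K).L ^ (K - n)), τ a ^ 2) ^ ((F.P K).d - 1)))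
          * (cB⁻¹ * ‖toL2B F n cB C‖ ^ 2) := by
  classical
  have hk : K - n ≤ (F.P K).m + (F.P K).K := by show K - n ≤ F.m + K; omega
  have hcB : (0 : ℝ) < cB := Fact.out
  rw [norm_sq_toL2, norm_sq_toL2B, ← mul_assoc cB⁻¹, inv_mul_cancel₀ hcB.ne', one_mul]
  -- per bond
  have hb : ∀ b : PBond (F.P K) 0,
      ∑ i, ∑ j, ‖((p ((b.src b.dir).val % (F.P K).L ^ (K - n)) * ∏ ν ∈ univ.erase b.dir, τ ((b.src ν).val % (F.P K).L ^ (K - n)))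
          • conjR (Unitary.toUnits (suIncl ((axialT W (Site.fibreSite 0 (K - n) (iterBlockOf (K - n) b.src) fun _ => (⟨0, pow_pos (F.P K).L_pos (K - n)⟩ : Fin ((F.P K).L ^ (K - n))))) b.src)))⁻¹
              (m • conjR (axialT (unitsField (toUField W)) (Site.fibreSite 0 (K - n) (iterBlockOf (K - n) b.src) fun _ => (⟨0, pow_pos (F.P K).L_pos (K - n)⟩ : Fin ((F.P K).L ^ (K - n)))) (embIter (K - n) (iterBlockOf (K - n) b.src)))
                (C ((bondShift (sites_eq F n K h)).symm ⟨iterBlockOf (K - n) b.src, b.dir⟩)))) i j‖ ^ 2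
        = (p ((b.src b.dir).val % (F.P K).L ^ (K - n)) * ∏ ν ∈ univ.erase b.dir, τ ((b.src ν).val % (F.P K).L ^ (K - n))) ^ 2
            * (m ^ 2 * ∑ i, ∑ j, ‖(C ((bondShift (sites_eq F n K h)).symm ⟨iterBlockOf (K - n) b.src, b.dir⟩)) i j‖ ^ 2) := by
    intro b
    rw [sum_normSq_smul_real, sum_normSq_conjR_eq ((U1 _).inv_mem (toUnits_suIncl_mem_U1 _)), sum_normSq_smul_real, sum_normSq_conjR_eq (axialFrame_mem_U1 F K W _ _)]
  simp only [hb]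
  have hre : ∑ b : PBond (F.P K) 0,
      (p ((b.src b.dir).val % (F.P K).L ^ (K - n)) * ∏ ν ∈ univ.erase b.dir, τ ((b.src ν).val % (F.P K).L ^ (K - n))) ^ 2
        * (m ^ 2 * ∑ i, ∑ j, ‖(C ((bondShift (sites_eq F n K h)).symm ⟨iterBlockOf (K - n) b.src, b.dir⟩)) i j‖ ^ 2)
      = ((∑ a : Fin ((F.P K).L ^ (K - n)), p a ^ 2) * (∑ a : Fin ((F.P K).L ^ (K - n)), τ a ^ 2) ^ ((F.P K).d - 1))
        * ∑ y : PBond (F.P K) (K - n), (m ^ 2 * ∑ i, ∑ j, ‖(C ((bondShift (sites_eq F n K h)).symm y)) i j‖ ^ 2) :=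
    sum_pbond_profileSq_mul hk p τ (fun y : PBond (F.P K) (K - n) => m ^ 2 * ∑ i, ∑ j, ‖(C ((bondShift (sites_eq F n K h)).symm y)) i j‖ ^ 2)
  have hsum : ∑ y : PBond (F.P K) (K - n), ∑ i, ∑ j, ‖(C ((bondShift (sites_eq F n K h)).symm y)) i j‖ ^ 2 = ∑ c : PBond (F.P n) 0, ∑ i, ∑ j, ‖C c i j‖ ^ 2 :=
    Fintype.sum_equiv (bondShift (sites_eq F n K h)).symm _ _ (fun _ => rfl)
  rw [hre, ← Finset.mul_sum, hsum]
  ring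

/-- ★ **THE SPILL-SHIFT ISOMETRY**: for a `U1`-valued frame field `u` and a real scalar `r`, `‖toL2B(c′ ↦ r • Ad_{u(c′)} C(e⁻¹⟨ĉ′.tgt, ĉ′.dir⟩))‖² = r²·‖toL2B C‖²` — `Ad_{U1}`-invariance bondwise and
the forward shift `ĉ′ ↦ ĉ′ + e_{ĉ′.dir}` is a bijection of the coarse bonds (✓`sum_pbond_runSite_one`). [cite: Balaban1985Averaging, (5) p.18, (18)–(20) p.21] -/
theorem normSq_toL2B_spillShift {u : PBond (F.P n) 0 → (Matrix (Fin 2) (Fin 2) ℂ)ˣ} (hu : ∀ c', u c' ∈ U1 (Matrix (Fin 2) (Fin 2) ℂ)) (r : ℝ)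
    (C : PBond (F.P n) 0 → Matrix (Fin 2) (Fin 2) ℂ) :
    ‖toL2B F n cB (fun c' : PBond (F.P n) 0 => r • conjR (u c')
        (C ((bondShift (sites_eq F n K h)).symm ⟨(bondShift (sites_eq F n K h) c').tgt, (bondShift (sites_eq F n K h) c').dir⟩)))‖ ^ 2
      = r ^ 2 * ‖toL2B F n cB C‖ ^ 2 := by
  classical
  rw [norm_sq_toL2B, norm_sq_toL2B]
  have hc : ∀ c' : PBond (F.P n) 0, ∑ i, ∑ j, ‖(r • conjR (u c')
        (C ((bondShift (sites_eq F n K h)).symm ⟨(bondShift (sites_eq F n K h) c').tgt, (bondShift (sites_eq F n K h) c').dir⟩))) i j‖ ^ 2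
      = r ^ 2 * ∑ i, ∑ j, ‖(C ((bondShift (sites_eq F n K h)).symm
          ⟨runSite (bondShift (sites_eq F n K h) c').src (bondShift (sites_eq F n K h) c').dir 1, (bondShift (sites_eq F n K h) c').dir⟩)) i j‖ ^ 2 := by
    intro c'
    rw [sum_normSq_smul_real, sum_normSq_conjR_eq (hu c'), runSite_one]
    rfl
  simp only [hc]
  rw [← Finset.mul_sum]
  -- re-index the coarse bonds through `e` and the forward shift (defeq-level steps: the printed family's `F.PP F.m K` vs `F.P K`)
  have hshift : ∑ c' : PBond (F.P n) 0, ∑ i, ∑ j, ‖(C ((bondShift (sites_eq F n K h)).symm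
          ⟨runSite (bondShift (sites_eq F n K h) c').src (bondShift (sites_eq F n K h) c').dir 1, (bondShift (sites_eq F n K h) c').dir⟩)) i j‖ ^ 2
      = ∑ c' : PBond (F.P n) 0, ∑ i, ∑ j, ‖C c' i j‖ ^ 2 :=
    calc ∑ c' : PBond (F.P n) 0, ∑ i, ∑ j, ‖(C ((bondShift (sites_eq F n K h)).symm
            ⟨runSite (bondShift (sites_eq F n K h) c').src (bondShift (sites_eq F n K h) c').dir 1, (bondShift (sites_eq F n K h) c').dir⟩)) i j‖ ^ 2
          = ∑ ĉ : PBond (F.P K) (K - n), (fun y : PBond (F.P K) (K - n) => ∑ i, ∑ j, ‖(C ((bondShift (sites_eq F n K h)).symm y)) i j‖ ^ 2) ⟨runSite ĉ.src ĉ.dir 1, ĉ.dir⟩ :=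
            Fintype.sum_equiv (bondShift (sites_eq F n K h)) _ _ (fun _ => rfl)
      _ = ∑ ĉ : PBond (F.P K) (K - n), (fun y : PBond (F.P K) (K - n) => ∑ i, ∑ j, ‖(C ((bondShift (sites_eq F n K h)).symm y)) i j‖ ^ 2) ĉ :=
            sum_pbond_runSite_one (fun y : PBond (F.P K) (K - n) => ∑ i, ∑ j, ‖(C ((bondShift (sites_eq F n K h)).symm y)) i j‖ ^ 2)
      _ = ∑ c' : PBond (F.P n) 0, ∑ i, ∑ j, ‖C c' i j‖ ^ 2 :=
            Fintype.sum_equiv (bondShift (sites_eq F n K h)).symm _ _ (fun _ => rfl)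
  rw [hshift]
  ring

end Member

/-! ## §4 The member: one bump per fine bond (disjoint supports) -/

section Bumps

variable (F : T3Family) (n K : ℕ) (h : n ≤ K) (c₀ cB : ℝ) [Fact (0 < c₀)] [Fact (0 < cB)]

/-- **ONE BUMP PER FINE BOND**: `Σ_ŷ A_ŷ(b) = A_C(b)` — only the bump `ŷ = ŷ_b` is non-zero at `b`, and there its cube gauge is the one of `A_C`. [cite: Balaban1985Averaging, (2) p.17] -/
theorem bump_sum_apply (W : GaugeField (F.P K) 0 (Matrix.specialUnitaryGroup (Fin 2) ℂ)) (p τ : ℕ → ℝ) (V : PBond (F.P K) (K - n) → Matrix (Fin 2) (Fin 2) ℂ) (b : PBond (F.P K) 0) :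
    ∑ ŷ : PBond (F.P K) (K - n), (if iterBlockOf (K - n) b.src = ŷ.src ∧ b.dir = ŷ.dir then
        (p ((b.src b.dir).val % (F.P K).L ^ (K - n)) * ∏ ν ∈ univ.erase b.dir, τ ((b.src ν).val % (F.P K).L ^ (K - n)))
          • conjR (Unitary.toUnits (suIncl ((axialT W (Site.fibreSite 0 (K - n) ŷ.src fun _ => (⟨0, pow_pos (F.P K).L_pos (K - n)⟩ : Fin ((F.P K).L ^ (K - n))))) b.src)))⁻¹ (V ŷ)
        else 0)
      = (p ((b.src b.dir).val % (F.P K).L ^ (K - n)) * ∏ ν ∈ univ.erase b.dir, τ ((b.src ν).val % (F.P K).L ^ (K - n)))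
          • conjR (Unitary.toUnits (suIncl ((axialT W (Site.fibreSite 0 (K - n) (iterBlockOf (K - n) b.src) fun _ => (⟨0, pow_pos (F.P K).L_pos (K - n)⟩ : Fin ((F.P K).L ^ (K - n))))) b.src)))⁻¹
              (V ⟨iterBlockOf (K - n) b.src, b.dir⟩) := by
  classical
  rw [Finset.sum_eq_single (⟨iterBlockOf (K - n) b.src, b.dir⟩ : PBond (F.P K) (K - n))]
  · rw [if_pos ⟨rfl, rfl⟩]
  · intro ŷ _ hne
    rw [if_neg]
    rintro ⟨h1, h2⟩
    exact hne ((pbond_eq_iff _ _).mpr ⟨h1.symm, h2.symm⟩)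
  · intro hb
    exact absurd (Finset.mem_univ _) hb

/-- ★ **DISJOINT SUPPORTS**: `Σ_ŷ ‖toL2 A_ŷ‖² = ‖toL2 (Σ_ŷ A_ŷ)‖²` — at each fine bond only `ŷ_b` contributes to either side. [cite: Balaban1985BackgroundPropagators, (3.11) p.392; Balaban1985Averaging, (2) p.17] -/
theorem sum_normSq_toL2_bump (W : GaugeField (F.P K) 0 (Matrix.specialUnitaryGroup (Fin 2) ℂ)) (p τ : ℕ → ℝ) (V : PBond (F.P K) (K - n) → Matrix (Fin 2) (Fin 2) ℂ) :
    ∑ ŷ : PBond (F.P K) (K - n), ‖toL2 F K c₀ (fun b : PBond (F.P K) 0 => if iterBlockOf (K - n) b.src = ŷ.src ∧ b.dir = ŷ.dir then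
        (p ((b.src b.dir).val % (F.P K).L ^ (K - n)) * ∏ ν ∈ univ.erase b.dir, τ ((b.src ν).val % (F.P K).L ^ (K - n)))
          • conjR (Unitary.toUnits (suIncl ((axialT W (Site.fibreSite 0 (K - n) ŷ.src fun _ => (⟨0, pow_pos (F.P K).L_pos (K - n)⟩ : Fin ((F.P K).L ^ (K - n))))) b.src)))⁻¹ (V ŷ)
        else 0)‖ ^ 2
      = ‖toL2 F K c₀ (fun b : PBond (F.P K) 0 =>
          (p ((b.src b.dir).val % (F.P K).L ^ (K - n)) * ∏ ν ∈ univ.erase b.dir, τ ((b.src ν).val % (F.P K).L ^ (K - n)))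
            • conjR (Unitary.toUnits (suIncl ((axialT W (Site.fibreSite 0 (K - n) (iterBlockOf (K - n) b.src) fun _ => (⟨0, pow_pos (F.P K).L_pos (K - n)⟩ : Fin ((F.P K).L ^ (K - n))))) b.src)))⁻¹
                (V ⟨iterBlockOf (K - n) b.src, b.dir⟩))‖ ^ 2 := by
  classical
  simp only [norm_sq_toL2]
  rw [← Finset.mul_sum, Finset.sum_comm]
  congr 1
  refine Finset.sum_congr rfl fun b _ => ?_
  -- at the bond `b` only `ŷ_b` contributes
  rw [Finset.sum_eq_single (⟨iterBlockOf (K - n) b.src, b.dir⟩ : PBond (F.P K) (K - n))]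
  · rw [if_pos ⟨rfl, rfl⟩]
  · intro ŷ _ hne
    rw [if_neg]
    · simp
    · rintro ⟨h1, h2⟩
      exact hne ((pbond_eq_iff _ _).mpr ⟨h1.symm, h2.symm⟩)
  · intro hb
    exact absurd (Finset.mem_univ _) hb

end Bumps

end Summit.QuantumFields.YangMills.Theorems.Prop7TransportedBumpNorms

end
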